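import Mathlib
import Summits.CriticalPhenomena.SAWScalingLimit.Theses.SAWDefectDecoherence
import Summits.CriticalPhenomena.SAWScalingLimit.Theorems.SAWDefectDecoherenceObservableToSLERNestedTransfer
import Summits.CriticalPhenomena.SAWScalingLimit.Theorems.SAWDefectDecoherenceObservableToSLERNestedLinkDefs
import Summits.CriticalPhenomena.SAWScalingLimit.Theorems.ObservableToSLE.Negative.Identification
import Literature.Probability.RandomPlanarGeometry.SLEExistenceNeEightHolds

/-!
# THE NESTED TRANSFER, reshape r4 (stub `stub_nestedTransfer` of the line `bridge-gate-renewal`: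
# anchored families, widely linked first good gates)

Support file for the registered stub `stub_nestedTransfer` (the nested transfer
`GateDecomposition → NestedRenewal → CarvedToSLEN → HexTight → FullIdentification`) of the line
`bridge-gate-renewal`, reshape r4, for the crux
`Summit.CriticalPhenomena.SAWScalingLimit.Theses.SAWDefectDecoherence.ObservableToSLER`
(item `stmt-CriticalPhenomena-14005`).  Re-thread of the landed r3 assembly
`Theorems/SAWDefectDecoherenceObservableToSLERNestedTransfer.lean` (`NestedGate.stub_nestedTransfer`,
`fullIdentification_of_productCellN`) through the r4 shapes of the two analytic inputs:

* the abundance input (`NestedRenewal`, r4) provides EXTERIOR-ANCHORED tame nested families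
  (`ExteriorAnchored`, two extra conjuncts, merely threaded through) and its failure event is
  "no pair of FIRST good gates `(n; q)`, `(n'; q')` at the two ends with a wide link
  `WideLink Ω δ ρ (S n ∪ T n') q q'`";
* the carved identification (`CarvedToSLEN`, r4) assumes the anchoring and its event carries the
  extra conjunct `WideLink Ω δ ρ (S n ∪ T n') q q'`.

Both insertions are functions of the cell label `(n, q, n', q')` and of `S, T` only, so the
product-cell structure (`eventually_productCellN`) is untouched, and the r4 per-mesh estimate
REDUCES to the landed r3 one (`abs_integral_sub_le_of_productCellN`) with `ε ↦ 2ε`: the r3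
failure event (no good renewal at some end) is inside the r4 failure event, and a cell whose
carved integral is `2ε`-off is either widely linked (inside the r4 identification event) or not
(then, by uniqueness of first good gates, inside the r4 failure event).

* `abs_integral_sub_le_of_productCellN_link` — the per-mesh estimate in the r4 shapes
  (`K C + 2 ε (1 + 4 ‖f‖)`);
* `fullIdentification_of_productCellN_link` — the soft assembly in the r4 shapes;
* `R4.stub_nestedTransfer` — the registered stub (r4 signature; the namespace `R4` avoids the
  clash with the landed r3 theorem `NestedGate.stub_nestedTransfer`).  `HexTight` is not used.
-/

noncomputable section

open scoped BigOperators Topology NNReal ENNReal Classical BoundedContinuousFunction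
open Filter Set MeasureTheory Metric
open Literature.Probability.LatticeModels (HexVertex hexGraph hexCenter triZeta Site)
open Literature.Probability.RandomPlanarGeometry
open Literature.Probability.RandomPlanarGeometry.SAW

namespace Summit.CriticalPhenomena.SAWScalingLimit.Theorems.ObservableToSLER.NestedGate

open Summit.CriticalPhenomena.SAWScalingLimit.Theorems.ObservableToSLER.BridgeGate
open Summit.CriticalPhenomena.SAWScalingLimit.Theorems.ObservableToSLE.Negative
  (eventually_isProbabilityMeasure_hexSAWLaw)
open Summit.CriticalPhenomena.SAWScalingLimit.Theses.SAWDefectDecoherence (HexTight)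

section PerMesh

variable {Ω : Set ℂ} {δ ρ R : ℝ} {S T : ℕ → Set HexVertex} {a b : HexVertex}

/-- **THE PER-MESH ESTIMATE IN THE r4 SHAPES (widely linked first good gates).**  At a mesh where
the critical SAW law is a probability measure and every walk lies in a product cell over the
families `S`, `T`: if the walks without a WIDELY LINKED pair of first good gates have mass `≤ ε`
(`NestedRenewal`, r4) and the walks whose widely linked first good gates carve a middle law more
than `ε`-off from `ν` against `f` have mass `≤ ε` (`CarvedToSLEN`, r4), then for a `K`-Lipschitz
bounded `f` the law of the curve is `K C + 2 ε (1 + 4 ‖f‖)`-close to `ν` against `f`.  Reduction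
to the r3 estimate `abs_integral_sub_le_of_productCellN` with `ε ↦ 2ε`: the wide-link predicate
depends on the cell label only (uniqueness of first good gates, `IsFirstGoodGateN.unique`). -/
theorem abs_integral_sub_le_of_productCellN_link (hΩ : Bornology.IsBounded Ω) (hδ : 0 < δ) {C : ℝ}
    (hC : 0 ≤ C)
    (hGD : ∀ (p q p' q' : HexVertex) (S T : Set HexVertex) (l₁ l₂ : List HexVertex)
      (B : Set (List HexVertex)),
      Disjoint S T →
      (∃ w₁ : (hexDomainGraph Ω δ).Walk a p, w₁.IsPath ∧ w₁.support = l₁ ∧ ∀ v ∈ l₁, v ∈ S) →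
      (∃ w₂ : (hexDomainGraph Ω δ).Walk p' b, w₂.IsPath ∧ w₂.support = l₂ ∧ ∀ v ∈ l₂, v ∈ T) →
      (hexDomainGraph Ω δ).Adj p q → (hexDomainGraph Ω δ).Adj q' p' →
      hexSAWWeight Ω δ a b
          {γ | ∃ mid ∈ B, mid.head? = some q ∧ mid.getLast? = some q' ∧
            (∀ v ∈ mid, v ∉ S ∧ v ∉ T) ∧ γ.walk.support = l₁ ++ mid ++ l₂} =
        ENNReal.ofReal (hexCriticalFugacity ^ (l₁.length + l₂.length)) *
          hexSAWWeight Ω δ q q'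
            {γ | γ.walk.support ∈ B ∧ ∀ v ∈ γ.walk.support, v ∉ S ∧ v ∉ T})
    (hcs : ∀ γ₀ : HexDomainSAW Ω δ a b, γ₀ ∈ productCellN Ω δ ρ R S T a b C)
    [IsProbabilityMeasure (hexSAWLaw Ω δ a b)]
    (ν : Measure (CurveClass ℂ)) [IsProbabilityMeasure ν] (f : CurveClass ℂ →ᵇ ℝ) {K : ℝ≥0}
    (hf : LipschitzWith K f) {ε : ℝ} (hε : 0 ≤ ε)
    (hRA : (hexSAWLaw Ω δ a b).real
      {γ | ¬ ∃ (n m : ℕ) (p q : HexVertex) (n' m' : ℕ) (p' q' : HexVertex),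
        IsFirstGoodGateN Ω δ ρ R S a γ.walk.support n m p q ∧
        IsFirstGoodGateN Ω δ ρ R T b γ.walk.support.reverse n' m' p' q' ∧
        WideLink Ω δ ρ (S n ∪ T n') q q'} ≤ ε)
    (hCTS : (hexSAWLaw Ω δ a b).real
      {γ | ∃ (n m : ℕ) (p q : HexVertex) (n' m' : ℕ) (p' q' : HexVertex),
        IsFirstGoodGateN Ω δ ρ R S a γ.walk.support n m p q ∧
        IsFirstGoodGateN Ω δ ρ R T b γ.walk.support.reverse n' m' p' q' ∧
        WideLink Ω δ ρ (S n ∪ T n') q q' ∧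
        ε < |(∫ ξ, f ξ.curve ∂(carvedLaw Ω δ (S n ∪ T n') q q')) - ∫ x, f x ∂ν|} ≤ ε) :
    |∫ γ, f γ.curve ∂(hexSAWLaw Ω δ a b) - ∫ x, f x ∂ν| ≤ K * C + 2 * ε * (1 + 4 * ‖f‖) := by
  set P := hexSAWLaw Ω δ a b
  -- the r3 failure event is inside the r4 failure event
  have hRA' : P.real {γ | ¬ (GoodRenewalAtN Ω δ ρ R S a γ.walk.support ∧
      GoodRenewalAtN Ω δ ρ R T b γ.walk.support.reverse)} ≤ 2 * ε := by
    refine (measureReal_mono ?_).trans (hRA.trans (by linarith))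
    intro γ hγ hex
    obtain ⟨n, m, p, q, n', m', p', q', h1, h2, -⟩ := hex
    exact hγ ⟨h1.goodRenewalAtN, h2.goodRenewalAtN⟩
  -- a `2ε`-bad cell is either widely linked (r4 identification event) or not (r4 failure event)
  have hCTS' : P.real
      {γ | ∃ (n m : ℕ) (p q : HexVertex) (n' m' : ℕ) (p' q' : HexVertex),
        IsFirstGoodGateN Ω δ ρ R S a γ.walk.support n m p q ∧
        IsFirstGoodGateN Ω δ ρ R T b γ.walk.support.reverse n' m' p' q' ∧
        2 * ε < |(∫ ξ, f ξ.curve ∂(carvedLaw Ω δ (S n ∪ T n') q q')) - ∫ x, f x ∂ν|} ≤ 2 * ε := by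
    set A : Set (HexDomainSAW Ω δ a b) :=
      {γ | ∃ (n m : ℕ) (p q : HexVertex) (n' m' : ℕ) (p' q' : HexVertex),
        IsFirstGoodGateN Ω δ ρ R S a γ.walk.support n m p q ∧
        IsFirstGoodGateN Ω δ ρ R T b γ.walk.support.reverse n' m' p' q' ∧
        WideLink Ω δ ρ (S n ∪ T n') q q' ∧
        ε < |(∫ ξ, f ξ.curve ∂(carvedLaw Ω δ (S n ∪ T n') q q')) - ∫ x, f x ∂ν|} with hA
    set B : Set (HexDomainSAW Ω δ a b) :=
      {γ | ¬ ∃ (n m : ℕ) (p q : HexVertex) (n' m' : ℕ) (p' q' : HexVertex),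
        IsFirstGoodGateN Ω δ ρ R S a γ.walk.support n m p q ∧
        IsFirstGoodGateN Ω δ ρ R T b γ.walk.support.reverse n' m' p' q' ∧
        WideLink Ω δ ρ (S n ∪ T n') q q'} with hB
    have hsub : {γ : HexDomainSAW Ω δ a b | ∃ (n m : ℕ) (p q : HexVertex) (n' m' : ℕ) (p' q' : HexVertex),
        IsFirstGoodGateN Ω δ ρ R S a γ.walk.support n m p q ∧
        IsFirstGoodGateN Ω δ ρ R T b γ.walk.support.reverse n' m' p' q' ∧
        2 * ε < |(∫ ξ, f ξ.curve ∂(carvedLaw Ω δ (S n ∪ T n') q q')) - ∫ x, f x ∂ν|} ⊆ A ∪ B := by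
      intro γ hγ
      obtain ⟨n, m, p, q, n', m', p', q', h1, h2, h3⟩ := hγ
      by_cases hW : WideLink Ω δ ρ (S n ∪ T n') q q'
      · exact Or.inl ⟨n, m, p, q, n', m', p', q', h1, h2, hW, by linarith⟩
      · refine Or.inr fun hex => hW ?_
        obtain ⟨n₁, m₁, p₁, q₁, n₁', m₁', p₁', q₁', h1', h2', hW'⟩ := hex
        obtain ⟨rfl, -, -, rfl⟩ := h1.unique h1'
        obtain ⟨rfl, -, -, rfl⟩ := h2.unique h2'
        exact hW'
    calc _ ≤ P.real (A ∪ B) := measureReal_mono hsub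
      _ ≤ P.real A + P.real B := measureReal_union_le _ _
      _ ≤ ε + ε := add_le_add hCTS hRA
      _ = 2 * ε := by ring
  exact abs_integral_sub_le_of_productCellN hΩ hδ hC hGD hcs ν f hf (by positivity) hRA' hCTS'

end PerMesh

section Final

/-- **Full identification from the product-cell structure over tame nested families, r4 shapes**
(the soft assembly of the nested transfer): `GateDecomposition`, `NestedRenewal` (r4: anchored
families, widely linked first good gates), `CarvedToSLEN` (r4) and the eventual product structure
of the cells (`productCellN`, prefix/suffix diameter bound `3 R`, for ALL tame nested families)
identify every probability subsequential limit law of the critical hexagonal SAW as the chordal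
SLE(8/3) law.  Same proof as the r3 `fullIdentification_of_productCellN`: `R₀` from
`CarvedToSLEN`, `R₁` from the cell structure, `R` small, `(ρ, N)` from `NestedRenewal`, and at
each small mesh the anchored families `S, T` of `NestedRenewal`, whose anchoring is fed to
`CarvedToSLEN`; per-mesh estimate `abs_integral_sub_le_of_productCellN_link`, limit along the
subsequence, `ε, R → 0`, separation of finite measures by bounded Lipschitz functions. -/
theorem fullIdentification_of_productCellN_link
    (hGD : ∀ (Ω : Set ℂ) (δ : ℝ) (a b p q p' q' : HexVertex) (S T : Set HexVertex)
       (l₁ l₂ : List HexVertex) (B : Set (List HexVertex)),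
       Disjoint S T →
       (∃ w₁ : (hexDomainGraph Ω δ).Walk a p, w₁.IsPath ∧ w₁.support = l₁ ∧ ∀ v ∈ l₁, v ∈ S) →
       (∃ w₂ : (hexDomainGraph Ω δ).Walk p' b, w₂.IsPath ∧ w₂.support = l₂ ∧ ∀ v ∈ l₂, v ∈ T) →
       (hexDomainGraph Ω δ).Adj p q → (hexDomainGraph Ω δ).Adj q' p' →
       hexSAWWeight Ω δ a b
           {γ | ∃ mid ∈ B, mid.head? = some q ∧ mid.getLast? = some q' ∧
             (∀ v ∈ mid, v ∉ S ∧ v ∉ T) ∧ γ.walk.support = l₁ ++ mid ++ l₂} =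
         ENNReal.ofReal (hexCriticalFugacity ^ (l₁.length + l₂.length)) *
           hexSAWWeight Ω δ q q'
             {γ | γ.walk.support ∈ B ∧ ∀ v ∈ γ.walk.support, v ∉ S ∧ v ∉ T})
    (hNR : ∀ (D : DobrushinDomain) (a b : ℝ → HexVertex), IsEmbEndpointApprox hexGraph hexCenter D a b →
       ∀ ε > (0 : ℝ), ∀ R > (0 : ℝ), ∃ ρ > (0 : ℝ), ∃ N : ℕ, ∀ᶠ δ : ℝ in 𝓝[>] 0,
         ∃ S T : ℕ → Set HexVertex,
           TameNestedFamily δ R N (a δ) S ∧ TameNestedFamily δ R N (b δ) T ∧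
           (∀ n, ExteriorAnchored D.carrier δ (S n) (a δ)) ∧
           (∀ n, ExteriorAnchored D.carrier δ (T n) (b δ)) ∧
           hexSAWLaw D.carrier δ (a δ) (b δ)
               {γ | ¬ ∃ (n m : ℕ) (p q : HexVertex) (n' m' : ℕ) (p' q' : HexVertex),
                   IsFirstGoodGateN D.carrier δ ρ R S (a δ) γ.walk.support n m p q ∧
                   IsFirstGoodGateN D.carrier δ ρ R T (b δ) γ.walk.support.reverse n' m' p' q' ∧
                   WideLink D.carrier δ ρ (S n ∪ T n') q q'} ≤
             ENNReal.ofReal ε)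
    (hCN : ∀ (D : DobrushinDomain) (a b : ℝ → HexVertex), IsEmbEndpointApprox hexGraph hexCenter D a b →
       ∀ (ν : Measure (CurveClass ℂ)), IsSLELaw ((8 : ℝ≥0) / 3) D ν →
       ∀ (f : CurveClass ℂ →ᵇ ℝ) (ε : ℝ), 0 < ε →
         ∃ R₀ > (0 : ℝ), ∀ R ∈ Set.Ioc (0 : ℝ) R₀, ∀ ρ > (0 : ℝ), ∀ N : ℕ,
           ∀ᶠ δ : ℝ in 𝓝[>] 0, ∀ S T : ℕ → Set HexVertex,
             TameNestedFamily δ R N (a δ) S → TameNestedFamily δ R N (b δ) T →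
             (∀ n, ExteriorAnchored D.carrier δ (S n) (a δ)) →
             (∀ n, ExteriorAnchored D.carrier δ (T n) (b δ)) →
             hexSAWLaw D.carrier δ (a δ) (b δ)
               {γ | ∃ (n m : ℕ) (p q : HexVertex) (n' m' : ℕ) (p' q' : HexVertex),
                   IsFirstGoodGateN D.carrier δ ρ R S (a δ) γ.walk.support n m p q ∧
                   IsFirstGoodGateN D.carrier δ ρ R T (b δ) γ.walk.support.reverse n' m' p' q' ∧
                   WideLink D.carrier δ ρ (S n ∪ T n') q q' ∧
                   ε < |(∫ ξ, f ξ.curve ∂(carvedLaw D.carrier δ (S n ∪ T n') q q')) - ∫ x, f x ∂ν|} ≤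
               ENNReal.ofReal ε)
    (hcells : ∀ (D : DobrushinDomain) (a b : ℝ → HexVertex), IsEmbEndpointApprox hexGraph hexCenter D a b →
       ∃ R₁ > (0 : ℝ), ∀ R ∈ Set.Ioc (0 : ℝ) R₁, ∀ (ρ : ℝ) (N : ℕ), ∀ᶠ δ : ℝ in 𝓝[>] 0,
         ∀ S T : ℕ → Set HexVertex, TameNestedFamily δ R N (a δ) S →
           TameNestedFamily δ R N (b δ) T →
           ∀ γ₀ : HexDomainSAW D.carrier δ (a δ) (b δ),
             γ₀ ∈ productCellN D.carrier δ ρ R S T (a δ) (b δ) (3 * R))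
    (D : DobrushinDomain) (a b : ℝ → HexVertex) (hab : IsEmbEndpointApprox hexGraph hexCenter D a b)
    (μ : Measure (CurveClass ℂ)) (hμ : IsProbabilityMeasure μ)
    (hsub : IsSubseqLimitLaw (fun δ (γ : HexDomainSAW D.carrier δ (a δ) (b δ)) => γ.curve)
      (fun δ => hexSAWLaw D.carrier δ (a δ) (b δ)) μ) :
    IsSLELaw ((8 : ℝ≥0) / 3) D μ := by
  obtain ⟨ν, hν⟩ := exists_isSLELaw_of_ne_eight (κ := (8 : ℝ≥0) / 3) (by positivity) (by norm_num) D
  obtain ⟨Γ, hΓ, rfl⟩ := hν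
  haveI := isProbabilityMeasure_preWienerMeasure'
  haveI : IsProbabilityMeasure (Literature.Probability.Process.preWienerMeasure.map Γ) :=
    Measure.isProbabilityMeasure_map hΓ.1
  suffices hμν : μ = Literature.Probability.Process.preWienerMeasure.map Γ from ⟨Γ, hΓ, hμν⟩
  set ν := Literature.Probability.Process.preWienerMeasure.map Γ with hνdef
  have hνlaw : IsSLELaw ((8 : ℝ≥0) / 3) D ν := ⟨Γ, hΓ, rfl⟩
  obtain ⟨s, hs, hlim⟩ := hsub
  refine ext_of_forall_lipschitz_integral_eq fun f K hf => ?_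
  -- `|∫ f dμ - ∫ f dν| ≤ η` for every `η > 0`
  have key : ∀ η : ℝ, 0 < η → |∫ x, f x ∂μ - ∫ x, f x ∂ν| ≤ η := by
    intro η hη
    set ε : ℝ := η / (4 * (1 + 4 * ‖f‖)) with hε
    have hε0 : 0 < ε := by positivity
    obtain ⟨R₀, hR₀, hCN'⟩ := hCN D a b hab ν hνlaw f ε hε0
    obtain ⟨R₁, hR₁, hcells'⟩ := hcells D a b hab
    set R : ℝ := min (min R₀ R₁) (η / (2 * (3 * K + 1))) with hR
    have hRpos : 0 < R := by positivity
    have hRR₀ : R ≤ R₀ := (min_le_left _ _).trans (min_le_left _ _)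
    have hRR₁ : R ≤ R₁ := (min_le_left _ _).trans (min_le_right _ _)
    have hK : (0 : ℝ) ≤ K := K.2
    have hRη : (K : ℝ) * (3 * R) ≤ η / 2 := by
      have h1 : R ≤ η / (2 * (3 * K + 1)) := min_le_right _ _
      calc (K : ℝ) * (3 * R) = 3 * K * R := by ring
        _ ≤ (3 * K + 1) * R := by nlinarith
        _ ≤ (3 * K + 1) * (η / (2 * (3 * K + 1))) := mul_le_mul_of_nonneg_left h1 (by positivity)
        _ = η / 2 := by field_simp
    have hεη : 2 * ε * (1 + 4 * ‖f‖) = η / 2 := by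
      rw [hε]; field_simp; ring
    obtain ⟨ρ, hρ, N, hNR'⟩ := hNR D a b hab ε hε0 R hRpos
    have hCN'' := hCN' R ⟨hRpos, hRR₀⟩ ρ hρ N
    have hcells'' := hcells' R ⟨hRpos, hRR₁⟩ ρ N
    have hprob := eventually_isProbabilityMeasure_hexSAWLaw hab
    have hev : ∀ᶠ δ : ℝ in 𝓝[>] 0,
        |∫ γ, f γ.curve ∂(hexSAWLaw D.carrier δ (a δ) (b δ)) - ∫ x, f x ∂ν| ≤ η := by
      filter_upwards [hNR', hCN'', hcells'', hprob, self_mem_nhdsWithin] with δ h1 h2 h3 h4 hδ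
      haveI := h4
      obtain ⟨S, T, hS, hT, hSa, hTb, h1⟩ := h1
      have hest := abs_integral_sub_le_of_productCellN_link (ρ := ρ) (R := R) (S := S) (T := T)
        D.isBounded hδ (by positivity : (0 : ℝ) ≤ 3 * R) (hGD D.carrier δ (a δ) (b δ))
        (h3 S T hS hT) ν f hf hε0.le (ENNReal.toReal_le_of_le_ofReal hε0.le h1)
        (ENNReal.toReal_le_of_le_ofReal hε0.le (h2 S T hS hT hSa hTb))
      calc _ ≤ K * (3 * R) + 2 * ε * (1 + 4 * ‖f‖) := hest
        _ ≤ η / 2 + η / 2 := add_le_add hRη hεη.le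
        _ = η := by ring
    have hev' : ∀ᶠ n in atTop, |∫ γ, f γ.curve ∂(hexSAWLaw D.carrier (s n) (a (s n)) (b (s n))) -
        ∫ x, f x ∂ν| ≤ η := hs.eventually hev
    have hcont : Tendsto (fun n => |∫ γ, f γ.curve ∂(hexSAWLaw D.carrier (s n) (a (s n)) (b (s n))) -
        ∫ x, f x ∂ν|) atTop (𝓝 |∫ x, f x ∂μ - ∫ x, f x ∂ν|) :=
      ((hlim f).sub tendsto_const_nhds).abs
    exact le_of_tendsto hcont hev'
  have h0 : |∫ x, f x ∂μ - ∫ x, f x ∂ν| ≤ 0 :=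
    le_of_forall_pos_le_add fun η hη => by rw [zero_add]; exact key η hη
  exact sub_eq_zero.1 (abs_eq_zero.1 (le_antisymm h0 (abs_nonneg _)))

end Final

end Summit.CriticalPhenomena.SAWScalingLimit.Theorems.ObservableToSLER.NestedGate

/-! ## The registered stub (r4 signature), in the namespace `…NestedGate.R4` (no clash with the
landed r3 theorem `NestedGate.stub_nestedTransfer`) -/

namespace Summit.CriticalPhenomena.SAWScalingLimit.Theorems.ObservableToSLER.NestedGate.R4

open Summit.CriticalPhenomena.SAWScalingLimit.Theorems.ObservableToSLER.BridgeGate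
open Summit.CriticalPhenomena.SAWScalingLimit.Theses.SAWDefectDecoherence (HexTight)

/-- **STUB 6 of the line `bridge-gate-renewal` (reshape r4) — THE NESTED TRANSFER**
`GateDecomposition → NestedRenewal → CarvedToSLEN → HexTight → FullIdentification` in the r4
shapes (exterior-anchored tame nested families; widely linked first good gates in both the
abundance failure event and the identification event): every probability subsequential limit law
of the critical hexagonal SAW in a Dobrushin domain is the chordal SLE(8/3) law.  Proof: the
eventual product structure of the cells over ALL tame nested families (`eventually_productCellN`)
feeds the soft assembly `fullIdentification_of_productCellN_link`; the anchoring provided by the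
abundance input is handed to the identification input, and the wide-link predicate, a function of
the cell label, only moves cells between the two small events.  The tightness hypothesis is not
needed for this implication. -/
theorem stub_nestedTransfer :
    (∀ (Ω : Set ℂ) (δ : ℝ) (a b p q p' q' : HexVertex) (S T : Set HexVertex) (l₁ l₂ : List HexVertex)
       (B : Set (List HexVertex)),
       Disjoint S T →
       (∃ w₁ : (hexDomainGraph Ω δ).Walk a p, w₁.IsPath ∧ w₁.support = l₁ ∧ ∀ v ∈ l₁, v ∈ S) →
       (∃ w₂ : (hexDomainGraph Ω δ).Walk p' b, w₂.IsPath ∧ w₂.support = l₂ ∧ ∀ v ∈ l₂, v ∈ T) →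
       (hexDomainGraph Ω δ).Adj p q → (hexDomainGraph Ω δ).Adj q' p' →
       hexSAWWeight Ω δ a b
           {γ | ∃ mid ∈ B, mid.head? = some q ∧ mid.getLast? = some q' ∧
             (∀ v ∈ mid, v ∉ S ∧ v ∉ T) ∧ γ.walk.support = l₁ ++ mid ++ l₂} =
         ENNReal.ofReal (hexCriticalFugacity ^ (l₁.length + l₂.length)) *
           hexSAWWeight Ω δ q q'
             {γ | γ.walk.support ∈ B ∧ ∀ v ∈ γ.walk.support, v ∉ S ∧ v ∉ T}) →
    (∀ (D : DobrushinDomain) (a b : ℝ → HexVertex), IsEmbEndpointApprox hexGraph hexCenter D a b →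
       ∀ ε > (0 : ℝ), ∀ R > (0 : ℝ), ∃ ρ > (0 : ℝ), ∃ N : ℕ, ∀ᶠ δ : ℝ in 𝓝[>] 0,
         ∃ S T : ℕ → Set HexVertex,
           TameNestedFamily δ R N (a δ) S ∧ TameNestedFamily δ R N (b δ) T ∧
           (∀ n, ExteriorAnchored D.carrier δ (S n) (a δ)) ∧
           (∀ n, ExteriorAnchored D.carrier δ (T n) (b δ)) ∧
           hexSAWLaw D.carrier δ (a δ) (b δ)
               {γ | ¬ ∃ (n m : ℕ) (p q : HexVertex) (n' m' : ℕ) (p' q' : HexVertex),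
                   IsFirstGoodGateN D.carrier δ ρ R S (a δ) γ.walk.support n m p q ∧
                   IsFirstGoodGateN D.carrier δ ρ R T (b δ) γ.walk.support.reverse n' m' p' q' ∧
                   WideLink D.carrier δ ρ (S n ∪ T n') q q'} ≤
             ENNReal.ofReal ε) →
    (∀ (D : DobrushinDomain) (a b : ℝ → HexVertex), IsEmbEndpointApprox hexGraph hexCenter D a b →
       ∀ (ν : Measure (CurveClass ℂ)), IsSLELaw ((8 : ℝ≥0) / 3) D ν →
       ∀ (f : CurveClass ℂ →ᵇ ℝ) (ε : ℝ), 0 < ε →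
         ∃ R₀ > (0 : ℝ), ∀ R ∈ Set.Ioc (0 : ℝ) R₀, ∀ ρ > (0 : ℝ), ∀ N : ℕ,
           ∀ᶠ δ : ℝ in 𝓝[>] 0, ∀ S T : ℕ → Set HexVertex,
             TameNestedFamily δ R N (a δ) S → TameNestedFamily δ R N (b δ) T →
             (∀ n, ExteriorAnchored D.carrier δ (S n) (a δ)) →
             (∀ n, ExteriorAnchored D.carrier δ (T n) (b δ)) →
             hexSAWLaw D.carrier δ (a δ) (b δ)
               {γ | ∃ (n m : ℕ) (p q : HexVertex) (n' m' : ℕ) (p' q' : HexVertex),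
                   IsFirstGoodGateN D.carrier δ ρ R S (a δ) γ.walk.support n m p q ∧
                   IsFirstGoodGateN D.carrier δ ρ R T (b δ) γ.walk.support.reverse n' m' p' q' ∧
                   WideLink D.carrier δ ρ (S n ∪ T n') q q' ∧
                   ε < |(∫ ξ, f ξ.curve ∂(carvedLaw D.carrier δ (S n ∪ T n') q q')) - ∫ x, f x ∂ν|} ≤
               ENNReal.ofReal ε) →
    HexTight →
    ∀ (D : DobrushinDomain) (a b : ℝ → HexVertex),
      IsEmbEndpointApprox hexGraph hexCenter D a b →
      ∀ μ : Measure (CurveClass ℂ), IsProbabilityMeasure μ →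
        IsSubseqLimitLaw (fun δ (γ : HexDomainSAW D.carrier δ (a δ) (b δ)) => γ.curve)
          (fun δ => hexSAWLaw D.carrier δ (a δ) (b δ)) μ →
        IsSLELaw ((8 : ℝ≥0) / 3) D μ :=
  fun hGD hNR hCN _ D a b hab μ hμ hsub =>
    fullIdentification_of_productCellN_link hGD hNR hCN
      (fun D a b hab => eventually_productCellN D a b hab) D a b hab μ hμ hsub

end Summit.CriticalPhenomena.SAWScalingLimit.Theorems.ObservableToSLER.NestedGate.R4

end
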